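import Literature.Topology.FourManifolds.Knots
import Literature.Topology.FourManifolds.DehnSurgery
import Literature.Topology.FourManifolds.CircleSurgery
import Literature.Topology.FourManifolds.LinkingNumber
import HarnessLib

/-!
# Twisted satellites along an unknotted axis (splice form) and axis patterns

Topic `Literature/Topology/FourManifolds` (knots in `S³`). This file defines, on top of the tree's
knots (`Knot`), oriented tubular neighbourhoods and framings (`Knot.TubularNbhd`,
`Knot.TubularNbhd.HasFraming`, `DehnSurgery.lean`), open gluings with explicit gluing maps
(`IsOpenGluingWith`, `CircleSurgery.lean`) and linking numbers (`Knot.HasLinkingNumber`,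
`LinkingNumber.lean`):

* `spliceRel νη νJ` — the **splice relation** between the complement `S³ ∖ η` of an *axis*
  `η` and the complement `S³ ∖ J` of a *companion* `J`, determined by tubular neighbourhoods
  `νη`, `νJ`: the point `νη (u, s • v)` (`u, v ∈ 𝕊 1`, `0 < s < 1`) of the punctured unit tube of
  `η` is identified with the point `νJ (v, (1 - s) • u)` of the punctured unit tube of `J`;
* `Knot.IsTwistedAxisSatellite K η J t K₁` — **`K₁` is the `t`-twisted satellite with companion
  `J` and pattern `(K, η)`**: the ambient `S³` of `K₁` is an open gluing of `S³ ∖ η ⊇ K` and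
  `S³ ∖ J` along `spliceRel νη νJ` with `νη` of framing `0` and `νJ` of framing `t`, and the
  gluing map of the `η`-side carries an oriented tubular neighbourhood of `K` onto one of `K₁`;
* `Knot.IsSpanningDiscMeetingTwice η K f`, `Knot.IsAxisPattern K η` — **axis patterns**: `η` is
  an unknot disjoint from `K`, `lk(η, K) = 0` (winding number `0`) and `η` bounds a smoothly
  embedded disc in `S³` meeting `K` in exactly two points (wrapping number `≤ 2`).

## The satellite construction and why this is it

A *pattern* is a knot `P` in the standard solid torus `W = S¹ × D²`; for a knot `J ⊂ S³` with
closed tubular neighbourhood `V = ι_J (S¹ × D²)`, where `ι_J` sends `S¹ × {∗}` to a **zero-framed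
longitude** `λ_J` and `{∗} × ∂D²` to a meridian `μ_J` (orientations preserved), the *satellite*
with pattern `P` and companion `J` is `P(J) = ι_J ∘ ι_P` (Lewark–Zibrowius (2024), Def. 2.7;
Cromwell (2004), Def. 4.2.1: `h : W → V` a *faithful* homeomorphism, `S = h(P)`); the
*`t`-twisted* satellite `P_t(J)` applies `t` full twists to the solid torus first, i.e. uses
`h (ℓ_W) = λ_J + t μ_J` instead of `λ_J` (Lewark–Zibrowius (2024), §1 p. 2 and Def. 2.8).
Here the pattern is presented, as is usual for Whitehead doubles and in the RBG-link literature,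
by a knot `K ⊂ S³` together with an **unknotted axis** `η ⊂ S³ ∖ K`: the solid torus is
`W = S³ ∖ N̊(η)`, whose meridian (the curve on `∂W` bounding a disc in `W`) is the `0`-framed
longitude `λ_η` of `η` and whose preferred longitude `ℓ_W` (null-homologous in `S³ ∖ W̊ = N(η)`)
is the meridian `μ_η` of `η`. Hence `P_t(J)` lives in
`S³ = (S³ ∖ N̊(J)) ∪_{T²} W` glued by `λ_η ↦ μ_J`, `μ_η ↦ λ_J + t μ_J`.

In the relational style of the tree (`IsIntegralSurgery`, `IsOpenGluing`: no quotient types, the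
pieces are the `Opens` `η.complement`, `J.complement` of `𝕊 3`) this closed gluing is the **open
gluing** of `A = S³ ∖ η` and `B = S³ ∖ J` along `spliceRel νη νJ`: on the torus layer
`{νη (u, s • v)} = {νJ (v, (1 - s) • u)}` the `u`-curves are the push-offs of `η` (`0`-framed, so
`= λ_η`) and at the same time the meridians of `J`, and the `v`-curves are the meridians of `η`
and at the same time the push-offs of `νJ` (`t`-framed, so `= λ_J + t μ_J`) — exactly the
identification above, as ORIENTED curves (push-offs oriented like the knots, meridians by
`det_pos`). The side `s → 0` of `A` (near the removed axis) is the outer boundary of the unit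
tube of `J`, beyond which `B` continues as the exterior of `J`; the side `s → 1` (the torus
`∂W`) is the side of the removed companion `J`. So the glued manifold is
`W ∪ (T² × (0,1)) ∪ (S³ ∖ νJ (S¹ × D̊²)) = W ∪_{T²} (S³ ∖ N̊(J))`, and `K ⊂ W` (we ask `K` to
miss the whole tube `νη`) becomes `K₁ = jA ∘ K`.

**Orientations (no mirror ambiguity).** The coordinate change `(u, s, v) ↦ (v, 1 - s, u)` of
`S¹ × (0,1) × S¹` has Jacobian `+1` (polar coordinates `(s, v)` on `ℝ²` are positively oriented),
and `νη`, `νJ` are orientation preserving (`det_pos`), so the two charts `jA`, `jB` of the glued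
`S³` induce the same orientation on the overlap. The last clause of `IsTwistedAxisSatellite`
(`ν₁ = jA ∘ νK` for ORIENTED tubular neighbourhoods `νK` of `K` and `ν₁` of `K₁`) forces `jA` to
preserve the orientation of `S³` near `K`, hence (the complement of a knot being connected)
everywhere, and then `jB` as well: `K₁` is the satellite, not its mirror image, and
`K₁ = jA ∘ K` as parametrised (oriented) knots (`IsTwistedAxisSatellite.exists_apply_eq`).
The orientation of the companion enters through the oriented push-off of `νJ` being matched with
the `det_pos`-oriented meridian of `η` (which links `η` once positively), as in
Lewark–Zibrowius' Def. 2.7 ("both identifications preserve orientations").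

**Special cases.** `t = 0`: the (untwisted) satellite `P(J)` with pattern `(K, η)`. `J = unknot`:
`S³ ∖ N̊(U)` is a solid torus whose meridian is `λ_U`, so the gluing re-embeds `W` with `t`
meridional twists: `K₁ = P_t(U)` is `K` with `t` full twists inserted where it passes through
the spanning disc of `η` (Lewark–Zibrowius (2024), §1: "`P_t` is obtained from `P` by applying
`t` right-handed full twists"; equivalently a `∓1/t` Rolfsen twist along `η`). The handedness of
"`t > 0`" is that of the tree's framing convention `Knot.TubularNbhd.HasFraming` / `det_pos`
(`DehnSurgery.lean`, "Orientation of `ν`": if the opposite global sign convention is preferred,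
only `t ↦ -t` changes).

**Axis patterns.** For the pattern `(K, η)` the *winding number* (algebraic intersection number
of `K` with a meridional disc of `W`, Lewark–Zibrowius Def. 2.7, Cromwell §4.4) is the class of
`K` in `H₁(W) = H₁(S³ ∖ η) ≅ ℤ`, i.e. the linking number `lk(η, K)`, available in the tree as
`Knot.HasLinkingNumber η K _ 0`; the *wrapping number* (minimal geometric intersection number with
a meridional disc) is bounded by `2` as soon as some smoothly embedded spanning disc of `η` in
`S³` meets `K` in exactly two points (`IsSpanningDiscMeetingTwice`; with `lk = 0` the wrapping
number is then `0` or `2`, the case `0` — `K` in a ball of `W`, `P(J) = P` for all `J`,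
Cromwell §4.4 — being degenerate but harmless). Discs are maps `f : ℝ² → ℝ⁴` restricted to the
closed unit disc `𝔻²`, with the conventions of `Knot.IsSliceDisc` (`SliceRibbon.lean`).

## What is NOT here (known results, deliberately not vendored as named facts)

* existence of the satellite (`∃ K₁, IsTwistedAxisSatellite K η J t K₁` for `η` unknotted,
  `K ⊂ S³ ∖ η`: the meridional Dehn filling of `S³ ∖ N̊(J)` is `S³`) and its uniqueness up to
  isotopy of `K₁` (uniqueness of tubular neighbourhoods and of gluings);
* `P₀(U) ≅ K` (`IsTwistedAxisSatellite K η unknot 0 K₁ → K₁.IsIsotopic K`; uses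
  `π₀ Diff⁺(S³) = 1`);
* the mirror law `IsTwistedAxisSatellite K η J t K₁ →
  IsTwistedAxisSatellite K.mirror η.mirror J.mirror.reverse (-t) K₁.mirror` (reflect all data by
  `reflectLast 3`; the reflected tubes regain `det_pos` after conjugating the fibre, framings
  change sign, and rewriting the reflected relation in the shape of `spliceRel` reverses one of
  `η`, `J`).
These are the natural next API lemmas; they are theorems of 3-manifold topology, not definitions.

## Sources

* L. Lewark, C. Zibrowius, *Rasmussen invariants of Whitehead doubles and other satellites*,
  J. reine angew. Math. 816 (2024) 241–296, arXiv:2208.13612: §1 p. 2 (patterns, `P(K)`, `P_t`,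
  `U`), Def. 2.7 (pattern, wrapping number, winding number, `ι_K`, satellite), Def. 2.8
  (`t`-twisted pattern and satellite, `P₀ = P`). [LewarkZibrowius2024]
* P. Cromwell, *Knots and Links*, CUP (2004): Def. 4.2.1 (satellite, companion, pattern,
  meridian/longitude/framing of an embedded solid torus, preferred longitude, faithful
  homeomorphism), §4.4 (wrapping and winding number of a pattern). [Cromwell2004]
* D. Rolfsen, *Knots and Links* (1976), §4.D (companionship), §9.H (twisting along an unknotted
  surgery curve) — the classical references, cited here after the tree's `Knots.lean`,
  `DehnSurgery.lean`. [Rolfsen1976]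

## Design notes

* Everything is stated for the tree's smooth parametrised knots `Knot = SphereEmbedding 1 3` and
  ORIENTED tubular neighbourhoods `Knot.TubularNbhd` (`det_pos`), exactly as `surgeryRel` /
  `IsIntegralSurgery`; the ambient of the satellite is the fixed `𝕊 3`, so for a knotted axis
  `η` (where the splice of the two complements is a homology sphere, not `S³` in general) the
  predicate is simply not the satellite construction — consumers pair it with `IsAxisPattern`.
* `IsAxisPattern` carries the `Knots` instance hypothesis `[SphereEmbedding.SmoothnessFacts]`
  under which `unknot`/`Knot.IsUnknot` exist (discharged by the instance of `KnotsProofs.lean`).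
* Requested by the SPC4 route `ZeroSurgeryExotic` (crux `ZseCruxRasmussen`, line
  `lz-transport-theta-window`), where Lewark–Zibrowius' transport law
  `s(P(J)) = s(P_{-θ(J)}(U))` is phrased with these predicates.
-/

open scoped Manifold ContDiff
open scoped _root_.Topology
open Function Set

noncomputable section

namespace Literature.Topology.FourManifolds

/-- Local notation: `𝔼 n` is the model Euclidean space `EuclideanSpace ℝ (Fin n)`. -/
local notation "𝔼 " n:arg => EuclideanSpace ℝ (Fin n)

/-- Local notation: `𝕊 n` is the unit sphere in `EuclideanSpace ℝ (Fin (n + 1))`, the standard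
`n`-sphere with its Mathlib manifold structure. -/
local notation "𝕊 " n:arg => (Metric.sphere (0 : EuclideanSpace ℝ (Fin (n + 1))) 1)

/-- Local notation: `𝔻²` is the closed unit disc in `ℝ²`. -/
local notation "𝔻²" => Metric.closedBall (0 : EuclideanSpace ℝ (Fin 2)) 1

/-! ### The splice relation -/

/-- The **splice relation** between the complement `S³ ∖ η` of the axis `η` and the complement
`S³ ∖ J` of the companion `J`, for oriented tubular neighbourhoods `νη` of `η` and `νJ` of `J`:
the point `νη (u, s • v)` of the punctured unit tube of `η` (`u, v ∈ 𝕊 1`, `0 < s < 1`) is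
related to the point `νJ (v, (1 - s) • u)` of the punctured unit tube of `J`. On each torus
layer the push-offs `u ↦ νη (u, s • v)` of `η` are the meridians `u ↦ νJ (v, (1 - s) • u)` of
`J`, and the meridians `v ↦ νη (u, s • v)` of `η` are the push-offs `v ↦ νJ (v, (1 - s) • u)` of
`νJ`, as oriented curves; the side `s → 0` of the removed axis is the outer side of `J`'s unit
tube and the torus `s → 1` is the side of the removed companion. With `νη` of framing `0` and
`νJ` of framing `t` this is the gluing `λ_η ↦ μ_J`, `μ_η ↦ λ_J + t μ_J` of the `t`-twisted
satellite construction along the solid torus `S³ ∖ N̊(η)` (Lewark–Zibrowius (2024), Def. 2.7: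
`ι_K` maps `S¹ × {∗}` to a zero-framed longitude and `{∗} × ∂D²` to a meridian, preserving
orientations; Cromwell (2004), Def. 4.2.1). The coordinate change `(u, s, v) ↦ (v, 1 - s, u)`
has Jacobian `+1`, so the gluing is orientation-compatible. [cite: LewarkZibrowius2024, Def. 2.7] -/
def spliceRel {η J : Knot} (νη : Knot.TubularNbhd η) (νJ : Knot.TubularNbhd J)
    (a : η.complement) (b : J.complement) : Prop :=
  ∃ (u v : 𝕊 1) (s : ℝ), s ∈ Ioo (0 : ℝ) 1 ∧ (a : 𝕊 3) = νη (u, s • (v : 𝔼 2)) ∧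
    (b : 𝕊 3) = νJ (v, (1 - s) • (u : 𝔼 2))

/-- Unfolding of `spliceRel`. [folklore] -/
theorem spliceRel_iff {η J : Knot} (νη : Knot.TubularNbhd η) (νJ : Knot.TubularNbhd J)
    (a : η.complement) (b : J.complement) :
    spliceRel νη νJ a b ↔ ∃ (u v : 𝕊 1) (s : ℝ), s ∈ Ioo (0 : ℝ) 1 ∧
      (a : 𝕊 3) = νη (u, s • (v : 𝔼 2)) ∧ (b : 𝕊 3) = νJ (v, (1 - s) • (u : 𝔼 2)) :=
  Iff.rfl

/-- A point of `S³ ∖ η` related by `spliceRel` to a point of `S³ ∖ J` lies in the tube `νη`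
(so a knot `K` missing `range νη` misses the glued region). [folklore] -/
theorem spliceRel.coe_mem_range_left {η J : Knot} {νη : Knot.TubularNbhd η}
    {νJ : Knot.TubularNbhd J} {a : η.complement} {b : J.complement} (h : spliceRel νη νJ a b) :
    (a : 𝕊 3) ∈ range νη := by
  obtain ⟨u, v, s, -, ha, -⟩ := h
  exact ⟨(u, s • (v : 𝔼 2)), ha.symm⟩

/-- A point of `S³ ∖ J` related by `spliceRel` to a point of `S³ ∖ η` lies in the tube `νJ`.
[folklore] -/
theorem spliceRel.coe_mem_range_right {η J : Knot} {νη : Knot.TubularNbhd η}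
    {νJ : Knot.TubularNbhd J} {a : η.complement} {b : J.complement} (h : spliceRel νη νJ a b) :
    (b : 𝕊 3) ∈ range νJ := by
  obtain ⟨u, v, s, -, -, hb⟩ := h
  exact ⟨(v, (1 - s) • (u : 𝔼 2)), hb.symm⟩

/-- The splice relation is symmetric in the two knots up to the reflection `s ↦ 1 - s` of the
radial parameter: `spliceRel νη νJ a b ↔ spliceRel νJ νη b a`. (So the splice form does not
prefer the axis over the companion; the asymmetry of the satellite construction is in the
framings `0` and `t` and in which complement contains the pattern knot.) [folklore] -/
theorem spliceRel_comm {η J : Knot} (νη : Knot.TubularNbhd η) (νJ : Knot.TubularNbhd J)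
    (a : η.complement) (b : J.complement) :
    spliceRel νη νJ a b ↔ spliceRel νJ νη b a := by
  constructor
  · rintro ⟨u, v, s, hs, ha, hb⟩
    refine ⟨v, u, 1 - s, ⟨sub_pos.2 hs.2, sub_lt_self _ hs.1⟩, hb, ?_⟩
    rwa [sub_sub_cancel]
  · rintro ⟨v, u, s, hs, hb, ha⟩
    refine ⟨u, v, 1 - s, ⟨sub_pos.2 hs.2, sub_lt_self _ hs.1⟩, ha, ?_⟩
    rwa [sub_sub_cancel]

namespace Knot

/-! ### Twisted satellites along an axis -/

/-- A point of a tubular neighbourhood `νK` of `K` whose image misses the knot `η` lies in the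
complement `S³ ∖ η`. [folklore] -/
theorem TubularNbhd.apply_mem_complement {K η : Knot} (νK : Knot.TubularNbhd K)
    (h : Disjoint (range νK) (range η)) (p : (𝕊 1) × (𝔼 2)) : νK p ∈ η.complement :=
  Set.disjoint_left.1 h (mem_range_self p)

/-- **`K₁` is the `t`-twisted satellite with companion `J` and pattern `(K, η)`** (splice form;
`η` is the axis, intended unknotted and disjoint from `K`, cf. `IsAxisPattern`): there are
oriented tubular neighbourhoods `νη` of `η` of framing `0` and `νJ` of `J` of framing `t`, with
`K` missing the tube `νη`, and smooth open embeddings `jA : S³ ∖ η → S³`, `jB : S³ ∖ J → S³`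
presenting the ambient `S³` of `K₁` as the open gluing of the two complements along
`spliceRel νη νJ` (`IsOpenGluingWith`: jointly surjective, `jA a = jB b ↔ spliceRel νη νJ a b`),
such that `jA` carries some oriented tubular neighbourhood `νK` of `K` inside `S³ ∖ η` onto an
oriented tubular neighbourhood `ν₁` of `K₁` (`ν₁ = jA ∘ νK`). In particular `K₁ = jA ∘ K`
(`IsTwistedAxisSatellite.exists_apply_eq`) and `jA` preserves orientation, so that `K₁` is the
satellite `P_t(J)` of Lewark–Zibrowius (2024), Def. 2.7–2.8 (pattern `P = K ⊂ S³ ∖ N̊(η)`,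
companion `J`, `t` full twists: gluing `λ_η ↦ μ_J`, `μ_η ↦ λ_J + t μ_J`), and not its mirror
image; Cromwell (2004), Def. 4.2.1 (`t = 0`: faithful `h`). For `t = 0` this is the satellite
`P(J)`; for `J = unknot` it is `P_t(U)`, the pattern with `t` full twists through the spanning
disc of `η` (handedness per the tree's framing convention, see the module docstring).
[cite: LewarkZibrowius2024, Def. 2.7 and Def. 2.8] -/
def IsTwistedAxisSatellite (K η J : Knot) (t : ℤ) (K₁ : Knot) : Prop :=
  ∃ (νη : Knot.TubularNbhd η) (νJ : Knot.TubularNbhd J) (jA : η.complement → 𝕊 3)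
    (jB : J.complement → 𝕊 3),
    νη.HasFraming 0 ∧ νJ.HasFraming t ∧ Disjoint (range K) (range νη) ∧
    IsOpenGluingWith (𝓡 3) (𝓡 3) (𝓡 3) (spliceRel νη νJ) jA jB ∧
    ∃ (νK : Knot.TubularNbhd K) (hK : Disjoint (range νK) (range η)) (ν₁ : Knot.TubularNbhd K₁),
      ∀ p, (ν₁ p : 𝕊 3) = jA ⟨νK p, νK.apply_mem_complement hK p⟩

namespace IsTwistedAxisSatellite

variable {K η J K₁ : Knot} {t : ℤ}

/-- The pattern knot of a twisted satellite misses its axis. [folklore] -/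
theorem disjoint (h : IsTwistedAxisSatellite K η J t K₁) : Disjoint (range K) (range η) := by
  obtain ⟨νη, -, -, -, -, -, hK, -⟩ := h
  exact hK.mono_right νη.range_subset_range

/-- The pattern knot of a twisted satellite lies in the complement of the axis. [folklore] -/
theorem apply_mem_complement (h : IsTwistedAxisSatellite K η J t K₁) (x : 𝕊 1) :
    K x ∈ η.complement :=
  mem_complement_of_disjoint h.disjoint.symm x

/-- **The satellite is the image of the pattern knot under the gluing map of the axis side**:
`K₁ x = jA (K x)` for the gluing maps of some presentation, as parametrised knots (evaluate the
tube identity `ν₁ = jA ∘ νK` on the zero section). Lewark–Zibrowius (2024), Def. 2.7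
(`P(K) = ι_K ∘ ι_P`). [cite: LewarkZibrowius2024, Def. 2.7] -/
theorem exists_apply_eq (h : IsTwistedAxisSatellite K η J t K₁) :
    ∃ (νη : Knot.TubularNbhd η) (νJ : Knot.TubularNbhd J) (jA : η.complement → 𝕊 3)
      (jB : J.complement → 𝕊 3) (hK : Disjoint (range η) (range K)),
      νη.HasFraming 0 ∧ νJ.HasFraming t ∧
      IsOpenGluingWith (𝓡 3) (𝓡 3) (𝓡 3) (spliceRel νη νJ) jA jB ∧
      ∀ x, K₁ x = jA ⟨K x, mem_complement_of_disjoint hK x⟩ := by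
  obtain ⟨νη, νJ, jA, jB, h0, ht, hKν, hG, νK, hνK, ν₁, hν⟩ := h
  refine ⟨νη, νJ, jA, jB, (hKν.mono_right νη.range_subset_range).symm, h0, ht, hG, fun x ↦ ?_⟩
  rw [← ν₁.coe_apply_zero x, hν (x, 0)]
  congr 2
  exact νK.coe_apply_zero x

/-- The satellite knot misses the image of the companion side outside the tube of `η`: a point
`K₁ x = jA (K x)` is never of the form `jB b` (the pattern knot misses the glued region
`range νη`). [folklore] -/
theorem apply_notMem_range (h : IsTwistedAxisSatellite K η J t K₁) :
    ∃ (νη : Knot.TubularNbhd η) (νJ : Knot.TubularNbhd J) (jA : η.complement → 𝕊 3)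
      (jB : J.complement → 𝕊 3),
      IsOpenGluingWith (𝓡 3) (𝓡 3) (𝓡 3) (spliceRel νη νJ) jA jB ∧ ∀ x, K₁ x ∉ range jB := by
  obtain ⟨νη, νJ, jA, jB, -, -, hKν, hG, νK, hνK, ν₁, hν⟩ := h
  refine ⟨νη, νJ, jA, jB, hG, fun x ↦ ?_⟩
  rintro ⟨b, hb⟩
  have hx : K₁ x = jA ⟨K x, mem_complement_of_disjoint
      (hKν.mono_right νη.range_subset_range).symm x⟩ := by
    rw [← ν₁.coe_apply_zero x, hν (x, 0)]
    congr 2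
    exact νK.coe_apply_zero x
  have hrel : spliceRel νη νJ ⟨K x, _⟩ b := (hG.2.2.2.2.2 _ b).1 (hx.symm.trans hb.symm)
  exact Set.disjoint_left.1 hKν (mem_range_self x) hrel.coe_mem_range_left

end IsTwistedAxisSatellite

/-! ### Axis patterns: unknotted axis, winding number `0`, wrapping number `≤ 2` -/

/-- `f : ℝ² → ℝ⁴` is a **smoothly embedded spanning disc of `η` inside `S³` meeting `K` in
exactly two points**: `f` is `C^∞`, an injective immersion on the closed unit disc `𝔻²`, maps
`𝔻²` into the unit sphere `𝕊 3 ⊆ ℝ⁴`, restricts to `η` on `𝕊 1 = ∂𝔻²`, and exactly two points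
of `𝔻²` are mapped into `K (𝕊 1)` (disc conventions of `Knot.IsSliceDisc`). Such a disc is a
meridional disc of the solid torus `S³ ∖ N̊(η)` (for `η` unknotted), so its existence bounds the
*wrapping number* of the pattern `(K, η)` — the minimal number of intersection points of `K` with
a meridional disc — by `2` (Lewark–Zibrowius (2024), Def. 2.7; Cromwell (2004), §4.4).
[cite: LewarkZibrowius2024, Def. 2.7] -/
def IsSpanningDiscMeetingTwice (η K : Knot) (f : 𝔼 2 → 𝔼 4) : Prop :=
  ContDiff ℝ ∞ f ∧ InjOn f 𝔻² ∧ (∀ x ∈ 𝔻², Injective (fderiv ℝ f x)) ∧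
    (∀ x ∈ 𝔻², f x ∈ Metric.sphere (0 : 𝔼 4) 1) ∧ (∀ x : 𝕊 1, f x = η x) ∧
    {x : 𝔼 2 | x ∈ 𝔻² ∧ f x ∈ (Subtype.val '' range K : Set (𝔼 4))}.ncard = 2

section AxisPattern

variable [SphereEmbedding.SmoothnessFacts]

/-- `(K, η)` is an **axis pattern**: the axis `η` is an unknot disjoint from `K`, the winding
number of `K` about `η` vanishes — `lk(η, K) = 0`, i.e. the class of `K` in
`H₁(S³ ∖ η) = π₁(S³ ∖ η)ᵃᵇ ≅ ℤ` is trivial (`Knot.HasLinkingNumber η K _ 0`) — and `η` bounds a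
smoothly embedded disc in `S³` meeting `K` in exactly two points. Thus `K ⊂ S³ ∖ N̊(η)` is a
pattern of winding number `0` and wrapping number at most `2` in the sense of Lewark–Zibrowius
(2024), Def. 2.7 (there: wrapping number exactly `2`; with `lk = 0` the wrapping number here is
`0` or `2`, and wrapping number `0` — `K` inside a ball of the solid torus — is the degenerate
case `P(J) = P` for every companion, Cromwell (2004), §4.4). Example: the pattern of the
Whitehead double (the clasp knot in an unknotted solid torus) has wrapping number `2` and winding
number `0` (Cromwell (2004), §4.4, Fig. 4.1). Carries `[SphereEmbedding.SmoothnessFacts]`, the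
`Knots` instance hypothesis under which `Knot.IsUnknot` exists. [cite: LewarkZibrowius2024, Def. 2.7] -/
def IsAxisPattern (K η : Knot) : Prop :=
  η.IsUnknot ∧ ∃ h : Disjoint (range η) (range K), η.HasLinkingNumber K h 0 ∧
    ∃ f, IsSpanningDiscMeetingTwice η K f

namespace IsAxisPattern

variable {K η : Knot}

/-- The axis of an axis pattern is unknotted. [folklore] -/
theorem isUnknot (h : IsAxisPattern K η) : η.IsUnknot :=
  h.1

/-- The axis of an axis pattern misses the pattern knot. [folklore] -/
theorem disjoint (h : IsAxisPattern K η) : Disjoint (range η) (range K) :=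
  h.2.fst

/-- The pattern knot has winding number (linking number with the axis) `0`. [folklore] -/
theorem hasLinkingNumber_zero (h : IsAxisPattern K η) : η.HasLinkingNumber K h.disjoint 0 :=
  h.2.snd.1

/-- The axis of an axis pattern bounds a smoothly embedded disc in `S³` meeting the pattern knot
in exactly two points. [folklore] -/
theorem exists_isSpanningDiscMeetingTwice (h : IsAxisPattern K η) :
    ∃ f, IsSpanningDiscMeetingTwice η K f :=
  h.2.snd.2

end IsAxisPattern

end AxisPattern

end Knot

end Literature.Topology.FourManifolds
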